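import Summits.HubbardSuperconductivity.HubbardSuperconductivity.Theorems.BalabanIRBirComplexStableXYRTEndResolventBound
import Summits.HubbardSuperconductivity.HubbardSuperconductivity.Theorems.BalabanIRBirComplexStableXYRTEndFeshbachFixedPoint
import Summits.HubbardSuperconductivity.HubbardSuperconductivity.Theorems.BalabanIRBirComplexStableXYRTEndDressedEigenvectors
import Summits.HubbardSuperconductivity.HubbardSuperconductivity.Theorems.BalabanIRBirComplexStableXYRTEndProjectorPowers
import Summits.HubbardSuperconductivity.HubbardSuperconductivity.Theorems.BalabanIRBirComplexStableXYRTEndComplementDecay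
import Summits.HubbardSuperconductivity.HubbardSuperconductivity.Theorems.BalabanIRBirComplexStableXYRTEndMuReal
import HarnessLib

/-!
# Crux `BirComplexStableXYR`, line `fat-gaussian-defect-calculus`, chapter T-end (lead c8): the abstract 1-D endgame

Helper file (`--supports stmt-HubbardSuperconductivity-14845`) assembling the registered wave-12 stubs T1–T6 into the **T-end lemma**:
stability of a dominant RANK-ONE projection under a small bounded perturbation, with power asymptotics UNIFORM in the exponent,
proved by elementary means (Neumann series, Feshbach/Schur-complement scalar fixed point, explicit dressed eigenvectors) — no
spectral theory.

Setting: `E` a complex Banach space, `e ∈ E`, `φ ∈ E*` with `φ e = 1`, `‖e‖, ‖φ‖ ≤ 1`; `p₀ = φ(·)e` (rank-one idempotent),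
`q₀ = 1 − p₀`; `t : E →L[ℂ] E` with block data `a = φ(te)`, `b = φ∘t∘q₀`, `c = q₀(te)`, `M = q₀tq₀`, assumed
`‖M‖ ≤ θ < 1`, `|a − 1|, ‖b‖, ‖c‖ ≤ ε`, `16ε ≤ 1 − θ`.

* `tEnd_powerAsymptotics` — there are `μ ∈ ℂ` with `|μ − 1| ≤ 2ε` and a rank-one idempotent `p` commuting with `t`, `tp = pt = μp`,
  `‖p − p₀‖ ≤ 32ε/(1−θ)`, such that for every `n ≥ 1`
  `‖tⁿ − μⁿ p‖ ≤ (θ + (200ε/(1−θ))(‖t‖+1))ⁿ`.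
* `tEnd_mu_real` — if moreover the Feshbach map `z ↦ a + b (z − M)⁻¹ c` commutes with complex conjugation on the disc
  `|z − 1| ≤ 2ε` (which a `J`-pseudo-Hermitian `t` with `Je = e`, `φ∘J = conj∘φ` provides), then that `μ` is REAL (and `> 0`).

In the crux this is the endgame of S5a in the regime `M ≫ KL²`: with `t` the transfer operator of the effective rotor chain over time
blocks `τ₀ = C·Kρ_tL²` (`p₀` = projection on the constant mode, `θ = e^{−cC}`, `ε = ε(K) → 0` the output of T-RG (i)),
`Tr t^{M/τ₀} = μ^{M/τ₀}·1 + O(θ₁^{M/τ₀})` has positive real part for all `M`, and no dominant complex-conjugate pair can form.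
No definition and no named fact is introduced; sorry-free. [folklore: Kato, Perturbation Theory for Linear Operators, §II.1–2
(finite-dimensional analytic perturbation), here in norm-quantitative elementary form]
-/

set_option linter.dupNamespace false -- `Summit.<S>.<S>.Theorems…` repeats the summit name (D-0017 layout)

noncomputable section

namespace Summit.HubbardSuperconductivity.HubbardSuperconductivity.Theorems.TEnd

open scoped ComplexConjugate

/-- **T-end lemma (power asymptotics, uniform in the exponent).**  See the module docstring; assembly of the landed stubs
`stub_resolventBound` (T1), `stub_feshbachFixedPoint` (T2), `stub_dressedEigenvectors` (T3), `stub_projectorPowers` (T4),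
`stub_complementDecay` (T5). -/
theorem tEnd_powerAsymptotics (E : Type) [NormedAddCommGroup E] [NormedSpace ℂ E] [CompleteSpace E]
    (t : E →L[ℂ] E) (e : E) (φ : E →L[ℂ] ℂ) (θ ε : ℝ)
    (he : ‖e‖ ≤ 1) (hφ : ‖φ‖ ≤ 1) (hφe : φ e = 1) (hθ0 : 0 ≤ θ) (hθ1 : θ < 1) (hε0 : 0 ≤ ε) (hε : 16 * ε ≤ 1 - θ)
    (hM : ‖((1 : E →L[ℂ] E) - φ.smulRight e) * t * ((1 : E →L[ℂ] E) - φ.smulRight e)‖ ≤ θ)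
    (hb : ‖φ.comp (t * ((1 : E →L[ℂ] E) - φ.smulRight e))‖ ≤ ε)
    (hc : ‖((1 : E →L[ℂ] E) - φ.smulRight e) (t e)‖ ≤ ε)
    (ha : ‖φ (t e) - 1‖ ≤ ε) :
    ∃ (μ : ℂ) (p : E →L[ℂ] E), ‖μ - 1‖ ≤ 2 * ε ∧
      μ = φ (t e) + (φ.comp (t * ((1 : E →L[ℂ] E) - φ.smulRight e)))
        (Ring.inverse (μ • (1 : E →L[ℂ] E) - ((1 : E →L[ℂ] E) - φ.smulRight e) * t * ((1 : E →L[ℂ] E) - φ.smulRight e))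
          (((1 : E →L[ℂ] E) - φ.smulRight e) (t e))) ∧
      p * p = p ∧ t * p = μ • p ∧ p * t = μ • p ∧ ‖p - φ.smulRight e‖ ≤ 32 * ε / (1 - θ) ∧
      ∀ n : ℕ, 1 ≤ n → ‖t ^ n - μ ^ n • p‖ ≤ (θ + 200 * ε / (1 - θ) * (‖t‖ + 1)) ^ n := by
  -- notation for the block data
  set q₀ : E →L[ℂ] E := (1 : E →L[ℂ] E) - φ.smulRight e with hq₀
  set M : E →L[ℂ] E := q₀ * t * q₀ with hMdef
  set b : E →L[ℂ] ℂ := φ.comp (t * q₀) with hbdef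
  set c : E := q₀ (t e) with hcdef
  set a : ℂ := φ (t e) with hadef
  have h4ε : 4 * ε ≤ 1 - θ := by linarith
  -- T1: resolvent bound
  have hR : ∀ μ : ℂ, θ < ‖μ‖ → IsUnit (μ • (1 : E →L[ℂ] E) - M) ∧
      ‖Ring.inverse (μ • (1 : E →L[ℂ] E) - M)‖ ≤ 1 / (‖μ‖ - θ) :=
    fun μ hμ => stub_resolventBound E M θ hM μ hμ
  -- T2: the dressed eigenvalue
  obtain ⟨μ, ⟨hμ1, hfix⟩, huniq⟩ :=
    stub_feshbachFixedPoint E M b c a θ ε hθ0 hθ1 hε0 h4ε hM hb hc ha hR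
  set R : E →L[ℂ] E := Ring.inverse (μ • (1 : E →L[ℂ] E) - M) with hRdef
  -- size of μ and of the resolvent at μ
  have hμnorm : θ < ‖μ‖ := by
    have h1 : 1 - 2 * ε ≤ ‖μ‖ := by
      have h2 : ‖(1 : ℂ)‖ - ‖μ‖ ≤ ‖(1 : ℂ) - μ‖ := norm_sub_norm_le (1 : ℂ) μ
      rw [norm_one, norm_sub_rev] at h2
      linarith
    linarith
  have hμ0 : μ ≠ 0 := by
    intro h; rw [h, norm_zero] at hμnorm; linarith
  have hU : IsUnit (μ • (1 : E →L[ℂ] E) - M) := (hR μ hμnorm).1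
  have hRle : ‖R‖ ≤ 2 / (1 - θ) := by
    have h1 := (hR μ hμnorm).2
    have h2 : (1 - θ) / 2 ≤ ‖μ‖ - θ := by
      have h4 : 1 - 2 * ε ≤ ‖μ‖ := by
        have h5 : ‖(1 : ℂ)‖ - ‖μ‖ ≤ ‖(1 : ℂ) - μ‖ := norm_sub_norm_le (1 : ℂ) μ
        rw [norm_one, norm_sub_rev] at h5
        linarith
      linarith
    have h3 : 0 < (1 - θ) / 2 := by linarith
    calc ‖R‖ ≤ 1 / (‖μ‖ - θ) := h1
      _ ≤ 1 / ((1 - θ) / 2) := one_div_le_one_div_of_le h3 h2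
      _ = 2 / (1 - θ) := by rw [one_div_div]
  -- T3: dressed eigenvectors
  have hT3 := stub_dressedEigenvectors E t e φ hφe μ hμ0 hU hfix
  set x : E := e + R c with hxdef
  set ψ : E →L[ℂ] ℂ := φ + b.comp R with hψdef
  obtain ⟨htx, hψt, hψx⟩ := hT3
  -- T5: estimates, with δ = 2ε/(1−θ)
  set δ : ℝ := 2 * ε / (1 - θ) with hδdef
  have h1θ : 0 < 1 - θ := by linarith
  have hδ0 : 0 ≤ δ := div_nonneg (by linarith) h1θ.le
  have hδ8 : δ ≤ 1 / 8 := by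
    rw [hδdef, div_le_iff₀ h1θ]; linarith
  have hv : ‖R c‖ ≤ δ := by
    calc ‖R c‖ ≤ ‖R‖ * ‖c‖ := R.le_opNorm c
      _ ≤ 2 / (1 - θ) * ε := mul_le_mul hRle hc (norm_nonneg _) (div_nonneg (by norm_num) h1θ.le)
      _ = δ := by rw [hδdef]; ring
  have hw : ‖b.comp R‖ ≤ δ := by
    calc ‖b.comp R‖ ≤ ‖b‖ * ‖R‖ := b.opNorm_comp_le R
      _ ≤ ε * (2 / (1 - θ)) := mul_le_mul hb hRle (norm_nonneg _) hε0
      _ = δ := by rw [hδdef]; ring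
  have hT5 := stub_complementDecay E t e φ (R c) (b.comp R) θ δ he hφ hφe hδ0 hδ8 hv hw hM
  obtain ⟨hψx1, hpp₀, hqtq, hpow⟩ := hT5
  -- ψ x ≠ 0
  have hψx0 : ψ x ≠ 0 := by
    intro h0
    have h1 : ‖(φ + b.comp R) (e + R c) - 1‖ ≤ 3 * δ := hψx1
    have h2 : (φ + b.comp R) (e + R c) = 0 := h0
    rw [h2, zero_sub, norm_neg, norm_one] at h1
    linarith
  -- T4: projector and power formula
  have hT4 := stub_projectorPowers E t x ψ μ htx hψt hψx0
  obtain ⟨hpp, htp, hpt, hpowers⟩ := hT4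
  set p : E →L[ℂ] E := (ψ x)⁻¹ • ψ.smulRight x with hpdef
  refine ⟨μ, p, hμ1, hfix, hpp, htp, hpt, ?_, fun n hn => ?_⟩
  · -- ‖p − p₀‖ ≤ 16δ = 32ε/(1−θ)
    calc ‖p - φ.smulRight e‖ ≤ 16 * δ := hpp₀
      _ = 32 * ε / (1 - θ) := by rw [hδdef]; ring
  · rw [hpowers n hn, add_sub_cancel_left]
    calc ‖(((1 : E →L[ℂ] E) - p) * t * ((1 : E →L[ℂ] E) - p)) ^ n‖
        ≤ (θ + 100 * δ * (‖t‖ + 1)) ^ n := hpow n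
      _ = (θ + 200 * ε / (1 - θ) * (‖t‖ + 1)) ^ n := by rw [hδdef]; ring

/-- **T-end lemma (reality of the dressed eigenvalue).**  Under the hypotheses of `tEnd_powerAsymptotics`, if the Feshbach map
`z ↦ a + b (z − M)⁻¹ c` commutes with complex conjugation on the disc `|z − 1| ≤ 2ε`, then the dressed eigenvalue `μ` given there
(characterised as the unique fixed point in the disc, T2) is real: no dominant complex-conjugate pair.  (T2 uniqueness + T6.) -/
theorem tEnd_mu_real (E : Type) [NormedAddCommGroup E] [NormedSpace ℂ E] [CompleteSpace E]
    (t : E →L[ℂ] E) (e : E) (φ : E →L[ℂ] ℂ) (θ ε : ℝ)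
    (hθ0 : 0 ≤ θ) (hθ1 : θ < 1) (hε0 : 0 ≤ ε) (hε : 4 * ε ≤ 1 - θ)
    (hM : ‖((1 : E →L[ℂ] E) - φ.smulRight e) * t * ((1 : E →L[ℂ] E) - φ.smulRight e)‖ ≤ θ)
    (hb : ‖φ.comp (t * ((1 : E →L[ℂ] E) - φ.smulRight e))‖ ≤ ε)
    (hc : ‖((1 : E →L[ℂ] E) - φ.smulRight e) (t e)‖ ≤ ε)
    (ha : ‖φ (t e) - 1‖ ≤ ε)
    (hconj : ∀ z : ℂ, ‖z - 1‖ ≤ 2 * ε →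
      φ (t e) + (φ.comp (t * ((1 : E →L[ℂ] E) - φ.smulRight e)))
        (Ring.inverse (conj z • (1 : E →L[ℂ] E) - ((1 : E →L[ℂ] E) - φ.smulRight e) * t * ((1 : E →L[ℂ] E) - φ.smulRight e))
          (((1 : E →L[ℂ] E) - φ.smulRight e) (t e))) =
      conj (φ (t e) + (φ.comp (t * ((1 : E →L[ℂ] E) - φ.smulRight e)))
        (Ring.inverse (z • (1 : E →L[ℂ] E) - ((1 : E →L[ℂ] E) - φ.smulRight e) * t * ((1 : E →L[ℂ] E) - φ.smulRight e))
          (((1 : E →L[ℂ] E) - φ.smulRight e) (t e)))))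
    (μ : ℂ) (hμ1 : ‖μ - 1‖ ≤ 2 * ε)
    (hfix : μ = φ (t e) + (φ.comp (t * ((1 : E →L[ℂ] E) - φ.smulRight e)))
        (Ring.inverse (μ • (1 : E →L[ℂ] E) - ((1 : E →L[ℂ] E) - φ.smulRight e) * t * ((1 : E →L[ℂ] E) - φ.smulRight e))
          (((1 : E →L[ℂ] E) - φ.smulRight e) (t e)))) :
    μ.im = 0 := by
  set q₀ : E →L[ℂ] E := (1 : E →L[ℂ] E) - φ.smulRight e with hq₀
  set M : E →L[ℂ] E := q₀ * t * q₀ with hMdef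
  set b : E →L[ℂ] ℂ := φ.comp (t * q₀) with hbdef
  set c : E := q₀ (t e) with hcdef
  set a : ℂ := φ (t e) with hadef
  have hR : ∀ μ : ℂ, θ < ‖μ‖ → IsUnit (μ • (1 : E →L[ℂ] E) - M) ∧
      ‖Ring.inverse (μ • (1 : E →L[ℂ] E) - M)‖ ≤ 1 / (‖μ‖ - θ) :=
    fun μ hμ => stub_resolventBound E M θ hM μ hμ
  obtain ⟨μ', _, huniq⟩ :=
    stub_feshbachFixedPoint E M b c a θ ε hθ0 hθ1 hε0 hε hM hb hc ha hR
  -- the Feshbach map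
  set G : ℂ → ℂ := fun z => a + b (Ring.inverse (z • (1 : E →L[ℂ] E) - M) c) with hGdef
  have hμ' : μ = μ' := huniq μ ⟨hμ1, hfix⟩
  refine stub_muReal G (2 * ε) μ (fun z hz => hconj z hz) ⟨hμ1, hfix⟩ (fun z hz => ?_)
  rw [hμ']
  exact huniq z hz

/-- **Stub T7 `stub_tEndPowerAsymptotics` (registered signature, verbatim): the T-end lemma, power asymptotics** — the
`∀`-form of `tEnd_powerAsymptotics`. -/
theorem stub_tEndPowerAsymptotics :
    ∀ (E : Type) [NormedAddCommGroup E] [NormedSpace ℂ E] [CompleteSpace E]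
      (t : E →L[ℂ] E) (e : E) (φ : E →L[ℂ] ℂ) (θ ε : ℝ),
      ‖e‖ ≤ 1 → ‖φ‖ ≤ 1 → φ e = 1 → 0 ≤ θ → θ < 1 → 0 ≤ ε → 16 * ε ≤ 1 - θ →
      ‖((1 : E →L[ℂ] E) - φ.smulRight e) * t * ((1 : E →L[ℂ] E) - φ.smulRight e)‖ ≤ θ →
      ‖φ.comp (t * ((1 : E →L[ℂ] E) - φ.smulRight e))‖ ≤ ε →
      ‖((1 : E →L[ℂ] E) - φ.smulRight e) (t e)‖ ≤ ε → ‖φ (t e) - 1‖ ≤ ε →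
      ∃ (μ : ℂ) (p : E →L[ℂ] E), ‖μ - 1‖ ≤ 2 * ε ∧
        μ = φ (t e) + (φ.comp (t * ((1 : E →L[ℂ] E) - φ.smulRight e)))
          (Ring.inverse (μ • (1 : E →L[ℂ] E) - ((1 : E →L[ℂ] E) - φ.smulRight e) * t * ((1 : E →L[ℂ] E) - φ.smulRight e))
            (((1 : E →L[ℂ] E) - φ.smulRight e) (t e))) ∧
        p * p = p ∧ t * p = μ • p ∧ p * t = μ • p ∧ ‖p - φ.smulRight e‖ ≤ 32 * ε / (1 - θ) ∧
        ∀ n : ℕ, 1 ≤ n → ‖t ^ n - μ ^ n • p‖ ≤ (θ + 200 * ε / (1 - θ) * (‖t‖ + 1)) ^ n :=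
  fun E _ _ _ t e φ θ ε he hφ hφe hθ0 hθ1 hε0 hε hM hb hc ha =>
    tEnd_powerAsymptotics E t e φ θ ε he hφ hφe hθ0 hθ1 hε0 hε hM hb hc ha

/-- **Stub T8 `stub_tEndMuReal` (registered signature, verbatim): the T-end lemma, reality of the dressed eigenvalue** — the
`∀`-form of `tEnd_mu_real`. -/
theorem stub_tEndMuReal :
    ∀ (E : Type) [NormedAddCommGroup E] [NormedSpace ℂ E] [CompleteSpace E]
      (t : E →L[ℂ] E) (e : E) (φ : E →L[ℂ] ℂ) (θ ε : ℝ),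
      0 ≤ θ → θ < 1 → 0 ≤ ε → 4 * ε ≤ 1 - θ →
      ‖((1 : E →L[ℂ] E) - φ.smulRight e) * t * ((1 : E →L[ℂ] E) - φ.smulRight e)‖ ≤ θ →
      ‖φ.comp (t * ((1 : E →L[ℂ] E) - φ.smulRight e))‖ ≤ ε →
      ‖((1 : E →L[ℂ] E) - φ.smulRight e) (t e)‖ ≤ ε → ‖φ (t e) - 1‖ ≤ ε →
      (∀ z : ℂ, ‖z - 1‖ ≤ 2 * ε →
        φ (t e) + (φ.comp (t * ((1 : E →L[ℂ] E) - φ.smulRight e)))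
          (Ring.inverse ((starRingEnd ℂ) z • (1 : E →L[ℂ] E) - ((1 : E →L[ℂ] E) - φ.smulRight e) * t * ((1 : E →L[ℂ] E) - φ.smulRight e))
            (((1 : E →L[ℂ] E) - φ.smulRight e) (t e))) =
        (starRingEnd ℂ) (φ (t e) + (φ.comp (t * ((1 : E →L[ℂ] E) - φ.smulRight e)))
          (Ring.inverse (z • (1 : E →L[ℂ] E) - ((1 : E →L[ℂ] E) - φ.smulRight e) * t * ((1 : E →L[ℂ] E) - φ.smulRight e))
            (((1 : E →L[ℂ] E) - φ.smulRight e) (t e))))) →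
      ∀ (μ : ℂ), ‖μ - 1‖ ≤ 2 * ε →
        μ = φ (t e) + (φ.comp (t * ((1 : E →L[ℂ] E) - φ.smulRight e)))
          (Ring.inverse (μ • (1 : E →L[ℂ] E) - ((1 : E →L[ℂ] E) - φ.smulRight e) * t * ((1 : E →L[ℂ] E) - φ.smulRight e))
            (((1 : E →L[ℂ] E) - φ.smulRight e) (t e))) →
        μ.im = 0 :=
  fun E _ _ _ t e φ θ ε hθ0 hθ1 hε0 hε hM hb hc ha hconj μ hμ1 hfix =>
    tEnd_mu_real E t e φ θ ε hθ0 hθ1 hε0 hε hM hb hc ha hconj μ hμ1 hfix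

end Summit.HubbardSuperconductivity.HubbardSuperconductivity.Theorems.TEnd

end
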